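import Mathlib.Data.Matrix.Mul
import Mathlib.LinearAlgebra.Matrix.DotProduct
import Mathlib.LinearAlgebra.FiniteDimensional.Lemmas
import Mathlib.LinearAlgebra.Dimension.Constructions
import Mathlib.Data.Real.Basic
import Mathlib.Tactic.Linarith
import Mathlib.Tactic.FieldSimp
import Mathlib.Tactic.Ring
import HarnessLib

/-!
# Conjugate directions and the conjugate-gradient method (Antoniou–Lu 2007, §6.2–6.4)

Literature anchor for A. Antoniou and W.-S. Lu, *Practical Optimization: Algorithms and
Engineering Applications* (Springer, 2007) [AntoniouLu2007], Chapter 6 "Conjugate-Direction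
Methods", §6.2 "Conjugate Directions" (Definition 6.1, Theorem 6.1, (6.2)–(6.6)), §6.3 "Basic
Conjugate-Directions Method" (Theorem 6.2 with (6.7)–(6.17), Theorem 6.3 with (6.18)–(6.23)) and
§6.4 "Conjugate-Gradient Method" (Hestenes–Stiefel; Theorem 6.4 with (6.24)–(6.37), the
simplifications (6.38)–(6.40) giving the Fletcher–Reeves form of `β_k`, Algorithm 6.2).  Held copy
`book:antoniou2007-practical-optimization`, pp. 103–112 read.

Setting.  `H : Matrix n n ℝ` is the (constant) Hessian of the quadratic
`f(x) = a + bᵀx + ½ xᵀHx` (6.2)/(6.7) (`quad a b H`), whose gradient is `g(x) = b + Hx` ((6.9),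
(6.26)); vectors `d_i, d_j` are **conjugate** (Definition 6.1) when `d_iᵀHd_j = 0`.  Iterations are
sequences `x, d : ℕ → ℝⁿ`, `α, β : ℕ → ℝ`; the exact step (6.17)/(6.25)
`α_k = -g_kᵀd_k / d_kᵀHd_k` and the conjugation coefficient (6.28) `β_k = g_{k+1}ᵀHd_k / d_kᵀHd_k`
are carried in the division-free forms `α_k (d_kᵀHd_k) = -g_kᵀd_k`, `β_k (d_kᵀHd_k) = g_{k+1}ᵀHd_k`.
Positive definiteness of `H` enters only where the text uses it (as `0 < d_kᵀHd_k`, or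
`vᵀHv > 0` for `v ≠ 0`), symmetry `Hᵀ = H` only where the printed argument transposes.

## Main statements (all proved)

* `linearIndependent_of_conjugate` — **Theorem 6.1**: nonzero `H`-conjugate vectors (with
  `d_iᵀHd_i > 0`) are linearly independent;
* `conjugate_expansion_coeff`, `minimizer_coeff` — (6.4)–(6.6): the coefficients of a vector in a
  conjugate family, and of the minimiser `x*` (`Hx* = -b`, (6.3)) in particular;
* `quad_line`, `exact_step_minimizes_line` — `f` along a line and **Theorem 6.3(b)**/(6.17): the
  step `α_k` minimises `f` on the line `x_k + αd_k`; `quad_sub_quad_solution`,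
  `quad_solution_isMin` — (6.3): `f(x) - f(x*) = ½ (x - x*)ᵀH(x - x*) ≥ 0`;
* `grad_succ` — (6.19) `g_{k+1} = g_k + α_kHd_k`; `grad_dotProduct_dir_self` — (6.21);
  `grad_orthogonal_directions` — **Theorem 6.3(a)** (6.23): `g_kᵀd_i = 0` for `i < k`;
* `eq_zero_of_orthogonal_conjugate_family`, `conjugateDirections_gradient_eq_zero`,
  `conjugateDirections_terminates` — **Theorem 6.2**: with `n` conjugate directions the gradient
  vanishes after `n` steps, `x_n = x*`;
* `conjugateGradient_invariants`, `conjugateGradient_gradients_orthogonal` — **Theorem 6.4**: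
  the conjugate-gradient directions (6.27)–(6.28) are conjugate (6.37) and the gradients mutually
  orthogonal (part (b)), by the simultaneous induction of the printed proof ((6.29)–(6.36), with
  the Krylov-span step (6.35) replaced by `α_iHd_i = g_{i+1} - g_i`);
* `cg_neg_grad_dotProduct_dir`, `cg_beta_fletcherReeves` — (6.38)–(6.40):
  `-g_kᵀd_k = g_kᵀg_k`, hence `α_k = ‖g_k‖²/d_kᵀHd_k` and `β_k = ‖g_{k+1}‖²/‖g_k‖²`.
-/

namespace Literature.Analysis.Convex.ConjugateDirections

open Finset Matrix

variable {n : Type*} [Fintype n]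

/-! ### The quadratic model (6.2) and a symmetric-form helper -/

/-- The quadratic objective `f(x) = a + bᵀx + ½ xᵀHx` of (6.2)/(6.7); its gradient is `b + Hx`
(6.9). [cite: AntoniouLu2007, §6.2 (6.2)] -/
noncomputable def quad (a : ℝ) (b : n → ℝ) (H : Matrix n n ℝ) (x : n → ℝ) : ℝ :=
  a + b ⬝ᵥ x + (1 / 2) * (x ⬝ᵥ H *ᵥ x)

/-- For symmetric `H` the form `vᵀHw` is symmetric. [folklore] -/
@[folklore] private theorem form_comm {H : Matrix n n ℝ} (hH : Hᵀ = H) (v w : n → ℝ) :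
    v ⬝ᵥ H *ᵥ w = w ⬝ᵥ H *ᵥ v := by
  rw [dotProduct_mulVec v H w, ← mulVec_transpose, hH]
  exact dotProduct_comm _ _

/-! ### §6.2: conjugate directions (Definition 6.1, Theorem 6.1, (6.4)–(6.6)) -/

section ConjugateFamilies

variable {ι : Type*} {H : Matrix n n ℝ} {d : ι → n → ℝ}

/-- **Theorem 6.1 (linear independence of conjugate vectors).** If `d_iᵀHd_j = 0` for `i ≠ j` and
`d_iᵀHd_i > 0` for all `i` (nonzero vectors, `H` positive definite), the family is linearly
independent: premultiplying `∑ α_j d_j = 0` by `d_iᵀH` leaves `α_i d_iᵀHd_i = 0`.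
[cite: AntoniouLu2007, §6.2 Theorem 6.1] -/
theorem linearIndependent_of_conjugate (hpos : ∀ i, 0 < d i ⬝ᵥ H *ᵥ d i)
    (hconj : ∀ i j, i ≠ j → d i ⬝ᵥ H *ᵥ d j = 0) : LinearIndependent ℝ d := by
  rw [linearIndependent_iff']
  intro s c hsum i hi
  have h0 : (∑ j ∈ s, c j • d j) ⬝ᵥ (H *ᵥ d i) = 0 := by rw [hsum, zero_dotProduct]
  rw [sum_dotProduct, Finset.sum_eq_single i] at h0
  · rw [smul_dotProduct, smul_eq_mul] at h0
    rcases mul_eq_zero.mp h0 with h | h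
    · exact h
    · exact absurd h (ne_of_gt (hpos i))
  · intro j _ hji
    rw [smul_dotProduct, hconj j i hji, smul_zero]
  · intro h
    exact absurd hi h

/-- **(6.4)–(6.5): coefficients in a conjugate family.** If `v = ∑_{i ∈ s} α_i d_i` with the `d_i`
pairwise conjugate, then `d_kᵀHv = α_k d_kᵀHd_k` for `k ∈ s`, i.e. `α_k = d_kᵀHv / d_kᵀHd_k`.
[cite: AntoniouLu2007, §6.2 (6.4)-(6.5)] -/
theorem conjugate_expansion_coeff (hconj : ∀ i j, i ≠ j → d i ⬝ᵥ H *ᵥ d j = 0) {s : Finset ι}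
    {α : ι → ℝ} {v : n → ℝ} (hv : v = ∑ i ∈ s, α i • d i) {k : ι} (hk : k ∈ s) :
    d k ⬝ᵥ H *ᵥ v = α k * (d k ⬝ᵥ H *ᵥ d k) := by
  subst hv
  rw [dotProduct_mulVec, dotProduct_sum, Finset.sum_eq_single k]
  · rw [dotProduct_smul, smul_eq_mul, ← dotProduct_mulVec]
  · intro j _ hjk
    rw [dotProduct_smul, ← dotProduct_mulVec, hconj k j (Ne.symm hjk), smul_zero]
  · intro h
    exact absurd hk h

/-- **(6.6): the minimiser in a conjugate basis.** If `Hx* = -b` (6.3) and `x* = ∑_{i ∈ s} α_i d_i`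
in a conjugate family with `d_kᵀHd_k > 0`, then `α_k = -d_kᵀb / d_kᵀHd_k`, so
`x* = -∑_k (d_kᵀb / d_kᵀHd_k) d_k`. [cite: AntoniouLu2007, §6.2 (6.3)-(6.6)] -/
theorem minimizer_coeff (hconj : ∀ i j, i ≠ j → d i ⬝ᵥ H *ᵥ d j = 0) {b xs : n → ℝ}
    (hxs : H *ᵥ xs = -b) {s : Finset ι} {α : ι → ℝ} (hexp : xs = ∑ i ∈ s, α i • d i) {k : ι}
    (hk : k ∈ s) (hpos : 0 < d k ⬝ᵥ H *ᵥ d k) :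
    α k = -(d k ⬝ᵥ b) / (d k ⬝ᵥ H *ᵥ d k) := by
  have h := conjugate_expansion_coeff hconj hexp hk
  rw [hxs, dotProduct_neg] at h
  rw [eq_div_iff (ne_of_gt hpos)]
  linarith

end ConjugateFamilies

/-! ### The quadratic along a line: Theorem 6.3(b), (6.17), and the minimiser (6.3) -/

section Quadratic

variable {a : ℝ} {b : n → ℝ} {H : Matrix n n ℝ}

/-- **`f` along a line.** For symmetric `H`,
`f(x + td) = f(x) + t (b + Hx)ᵀd + ½ t² dᵀHd` — the computation behind (6.17) and Theorem 6.3(b).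
[cite: AntoniouLu2007, §6.3 (6.14)-(6.17)] -/
theorem quad_line (hH : Hᵀ = H) (x d : n → ℝ) (t : ℝ) :
    quad a b H (x + t • d) =
      quad a b H x + t * ((b + H *ᵥ x) ⬝ᵥ d) + (1 / 2) * t ^ 2 * (d ⬝ᵥ H *ᵥ d) := by
  have hs : x ⬝ᵥ H *ᵥ d = d ⬝ᵥ H *ᵥ x := form_comm hH x d
  simp only [quad, mulVec_add, mulVec_smul, dotProduct_add, add_dotProduct, dotProduct_smul,
    smul_dotProduct, smul_eq_mul]
  rw [dotProduct_comm (H *ᵥ x) d, dotProduct_comm b d, dotProduct_comm b x] at *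
  rw [hs]
  ring

/-- **Theorem 6.3(b) / (6.17): the exact step minimises `f` on the line.** If `dᵀHd > 0` and
`α dᵀHd = -(b + Hx)ᵀd` (i.e. `α = -gᵀd / dᵀHd`), then `f(x + αd) ≤ f(x + td)` for every `t`;
indeed `f(x + td) - f(x + αd) = ½ dᵀHd (t - α)²`. [cite: AntoniouLu2007, §6.3 Theorem 6.3(b), (6.17)] -/
theorem exact_step_minimizes_line (hH : Hᵀ = H) (x d : n → ℝ) {α : ℝ}
    (hpos : 0 < d ⬝ᵥ H *ᵥ d) (hα : α * (d ⬝ᵥ H *ᵥ d) = -((b + H *ᵥ x) ⬝ᵥ d)) (t : ℝ) :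
    quad a b H (x + α • d) ≤ quad a b H (x + t • d) := by
  rw [quad_line hH, quad_line hH]
  set q := d ⬝ᵥ H *ᵥ d with hq
  set p := (b + H *ᵥ x) ⬝ᵥ d with hp
  have hp' : p = -(α * q) := by linarith
  have key : (t * p + 1 / 2 * t ^ 2 * q) - (α * p + 1 / 2 * α ^ 2 * q) =
      1 / 2 * q * (t - α) ^ 2 := by
    rw [hp']; ring
  nlinarith [mul_nonneg (le_of_lt hpos) (sq_nonneg (t - α))]

/-- **(6.3): the stationary point is the minimiser.** For symmetric `H` and `Hx* = -b`,
`f(x) - f(x*) = ½ (x - x*)ᵀH(x - x*)`. [cite: AntoniouLu2007, §6.2 (6.3)] -/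
theorem quad_sub_quad_solution (hH : Hᵀ = H) {xs : n → ℝ} (hxs : H *ᵥ xs = -b) (x : n → ℝ) :
    quad a b H x - quad a b H xs = (1 / 2) * ((x - xs) ⬝ᵥ H *ᵥ (x - xs)) := by
  have h1 : x ⬝ᵥ H *ᵥ xs = xs ⬝ᵥ H *ᵥ x := form_comm hH x xs
  have h2 : x ⬝ᵥ H *ᵥ xs = -(b ⬝ᵥ x) := by rw [hxs, dotProduct_neg, dotProduct_comm]
  have h3 : xs ⬝ᵥ H *ᵥ xs = -(b ⬝ᵥ xs) := by rw [hxs, dotProduct_neg, dotProduct_comm]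
  simp only [quad, mulVec_sub, dotProduct_sub, sub_dotProduct]
  linarith

/-- With `H` moreover positive semidefinite, `x*` minimises `f` ("at the minimizer `x*` of `f(x)`,
`g = 0` and thus `Hx* = -b`"). [cite: AntoniouLu2007, §6.2 (6.3)] -/
theorem quad_solution_isMin (hH : Hᵀ = H) (hpsd : ∀ v : n → ℝ, 0 ≤ v ⬝ᵥ H *ᵥ v) {xs : n → ℝ}
    (hxs : H *ᵥ xs = -b) (x : n → ℝ) : quad a b H xs ≤ quad a b H x := by
  have h := quad_sub_quad_solution (a := a) hH hxs x
  nlinarith [hpsd (x - xs)]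

end Quadratic

/-! ### §6.3: the conjugate-directions method (Theorems 6.2 and 6.3(a)) -/

section ConjugateDirectionsMethod

variable {b : n → ℝ} {H : Matrix n n ℝ} {x d g : ℕ → n → ℝ} {α : ℕ → ℝ}

/-- **(6.19): gradient recursion.** From `x_{k+1} = x_k + α_kd_k` (6.8) and `g_k = b + Hx_k` (6.9):
`g_{k+1} = g_k + α_kHd_k`. [cite: AntoniouLu2007, §6.3 (6.19)] -/
theorem grad_succ (hg : ∀ k, g k = b + H *ᵥ x k) (hx : ∀ k, x (k + 1) = x k + α k • d k)
    (k : ℕ) : g (k + 1) = g k + α k • H *ᵥ d k := by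
  rw [hg, hg, hx, mulVec_add, mulVec_smul, add_assoc]

/-- **(6.21): the new gradient is orthogonal to the last direction** when the step is exact,
`α_k d_kᵀHd_k = -g_kᵀd_k`. [cite: AntoniouLu2007, §6.3 (6.20)-(6.21)] -/
theorem grad_dotProduct_dir_self (hg : ∀ k, g k = b + H *ᵥ x k)
    (hx : ∀ k, x (k + 1) = x k + α k • d k)
    (hα : ∀ k, α k * (d k ⬝ᵥ H *ᵥ d k) = -(g k ⬝ᵥ d k)) (k : ℕ) :
    g (k + 1) ⬝ᵥ d k = 0 := by
  rw [grad_succ hg hx, add_dotProduct, smul_dotProduct, smul_eq_mul, dotProduct_comm (H *ᵥ d k)]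
  linarith [hα k]

/-- **Theorem 6.3(a) / (6.23): the gradient is orthogonal to all previous directions.** For a
pairwise conjugate family `d_iᵀHd_j = 0` (`i ≠ j`) and exact steps, `g_kᵀd_i = 0` for all
`i < k` — the induction (6.18)–(6.23). Consequently `x_k` minimises `f` over
`x_0 + span{d_0, …, d_{k-1}}`. [cite: AntoniouLu2007, §6.3 Theorem 6.3(a), (6.18)-(6.23)] -/
theorem grad_orthogonal_directions (hg : ∀ k, g k = b + H *ᵥ x k)
    (hx : ∀ k, x (k + 1) = x k + α k • d k)
    (hα : ∀ k, α k * (d k ⬝ᵥ H *ᵥ d k) = -(g k ⬝ᵥ d k))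
    (hconj : ∀ i j, i ≠ j → d i ⬝ᵥ H *ᵥ d j = 0) :
    ∀ k i, i < k → g k ⬝ᵥ d i = 0 := by
  intro k
  induction k with
  | zero => intro i hi; exact absurd hi (Nat.not_lt_zero i)
  | succ k ih =>
    intro i hi
    rcases Nat.lt_succ_iff_lt_or_eq.mp hi with hlt | rfl
    · rw [grad_succ hg hx, add_dotProduct, smul_dotProduct, smul_eq_mul, ih i hlt,
        dotProduct_comm (H *ᵥ d k), hconj i k (ne_of_lt hlt), mul_zero, add_zero]
    · exact grad_dotProduct_dir_self hg hx hα i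

/-- **A vector orthogonal to `n` linearly independent vectors of `ℝⁿ` vanishes** (they span, so
`gᵀg = 0`) — the linear-algebra step closing the proof of Theorem 6.2. [folklore] -/
@[folklore] private theorem eq_zero_of_dotProduct_basis {m : ℕ} (hm : m = Fintype.card n)
    {v : Fin m → n → ℝ} (hli : LinearIndependent ℝ v) {w : n → ℝ} (hw : ∀ i, w ⬝ᵥ v i = 0) :
    w = 0 := by
  have hspan : Submodule.span ℝ (Set.range v) = ⊤ :=
    hli.span_eq_top_of_card_eq_finrank' (by rw [Module.finrank_fintype_fun_eq_card, Fintype.card_fin, hm])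
  have hmem : w ∈ Submodule.span ℝ (Set.range v) := by rw [hspan]; exact Submodule.mem_top
  obtain ⟨c, hc⟩ := Submodule.mem_span_range_iff_exists_fun ℝ |>.mp hmem
  have h0 : w ⬝ᵥ w = 0 := by
    calc w ⬝ᵥ w = w ⬝ᵥ ∑ i, c i • v i := by rw [hc]
      _ = ∑ i, w ⬝ᵥ (c i • v i) := dotProduct_sum _ _ _
      _ = 0 := Finset.sum_eq_zero fun i _ => by rw [dotProduct_smul, hw i, smul_zero]
  exact dotProduct_self_eq_zero.mp h0

/-- **Theorem 6.2, the mechanism: a gradient orthogonal to `n` conjugate directions is zero.**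
If `d_0, …, d_{n-1}` (`n = card` of the index type) satisfy `d_iᵀHd_i > 0` and `d_iᵀHd_j = 0`
(`i ≠ j`), and `wᵀd_i = 0` for all `i < n`, then `w = 0` (Theorem 6.1 makes them a basis).
[cite: AntoniouLu2007, §6.3 Theorem 6.2 (proof, (6.10))] -/
theorem eq_zero_of_orthogonal_conjugate_family {m : ℕ} (hm : m = Fintype.card n)
    (hpos : ∀ i < m, 0 < d i ⬝ᵥ H *ᵥ d i)
    (hconj : ∀ i j, i < m → j < m → i ≠ j → d i ⬝ᵥ H *ᵥ d j = 0) {w : n → ℝ}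
    (hw : ∀ i < m, w ⬝ᵥ d i = 0) : w = 0 := by
  have hli : LinearIndependent ℝ (fun i : Fin m => d i) :=
    linearIndependent_of_conjugate (fun i => hpos i i.isLt)
      (fun i j hij => hconj i j i.isLt j.isLt (Fin.val_injective.ne hij))
  exact eq_zero_of_dotProduct_basis hm hli (fun i => hw i i.isLt)

/-- **Theorem 6.2 (convergence of the conjugate-directions method in `n` iterations): the gradient
vanishes at `x_n`.** With `n` pairwise conjugate directions, `d_kᵀHd_k > 0`, and exact steps
(6.8)/(6.17), `g_n = b + Hx_n = 0`. [cite: AntoniouLu2007, §6.3 Theorem 6.2, (6.7)-(6.17)] -/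
theorem conjugateDirections_gradient_eq_zero {m : ℕ} (hm : m = Fintype.card n)
    (hg : ∀ k, g k = b + H *ᵥ x k) (hx : ∀ k, x (k + 1) = x k + α k • d k)
    (hα : ∀ k, α k * (d k ⬝ᵥ H *ᵥ d k) = -(g k ⬝ᵥ d k))
    (hpos : ∀ i < m, 0 < d i ⬝ᵥ H *ᵥ d i) (hconj : ∀ i j, i ≠ j → d i ⬝ᵥ H *ᵥ d j = 0) :
    g m = 0 :=
  eq_zero_of_orthogonal_conjugate_family hm hpos (fun i j _ _ hij => hconj i j hij)
    (fun i hi => grad_orthogonal_directions hg hx hα hconj m i hi)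

/-- **Theorem 6.2: `x_n = x*`.** If moreover `H` is positive definite and `Hx* = -b`, then
`x_n = x*`, the unique solution of the quadratic problem.
[cite: AntoniouLu2007, §6.3 Theorem 6.2] -/
theorem conjugateDirections_terminates {m : ℕ} (hm : m = Fintype.card n)
    (hg : ∀ k, g k = b + H *ᵥ x k) (hx : ∀ k, x (k + 1) = x k + α k • d k)
    (hα : ∀ k, α k * (d k ⬝ᵥ H *ᵥ d k) = -(g k ⬝ᵥ d k))
    (hpos : ∀ i < m, 0 < d i ⬝ᵥ H *ᵥ d i) (hconj : ∀ i j, i ≠ j → d i ⬝ᵥ H *ᵥ d j = 0)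
    (hpd : ∀ v : n → ℝ, v ≠ 0 → 0 < v ⬝ᵥ H *ᵥ v) {xs : n → ℝ} (hxs : H *ᵥ xs = -b) :
    x m = xs := by
  have h0 : g m = 0 := conjugateDirections_gradient_eq_zero hm hg hx hα hpos hconj
  rw [hg] at h0
  have hH0 : H *ᵥ (x m - xs) = 0 := by
    rw [mulVec_sub, hxs]
    have : H *ᵥ x m = -b := by
      have := congrArg (fun v => v - b) h0
      simpa using this
    rw [this, sub_self]
  by_contra hne
  have hlt := hpd (x m - xs) (sub_ne_zero.mpr hne)
  rw [hH0, dotProduct_zero] at hlt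
  exact lt_irrefl 0 hlt

end ConjugateDirectionsMethod

/-! ### §6.4: the conjugate-gradient method (Theorem 6.4, (6.38)–(6.40)) -/

section ConjugateGradient

variable {b : n → ℝ} {H : Matrix n n ℝ} {x d g : ℕ → n → ℝ} {α β : ℕ → ℝ}

/-- **Theorem 6.4 (the conjugate-gradient directions are conjugate and the gradients orthogonal).**
For symmetric `H`, the recursion (6.24)–(6.28) with `d_0 = -g_0`, exact steps
`α_k d_kᵀHd_k = -g_kᵀd_k` and `β_k d_kᵀHd_k = g_{k+1}ᵀHd_k`, as long as the steps `α_i`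
(`i < K`) are nonzero (i.e. before termination, cf. (6.38)): for every `k ≤ K`,
`g_kᵀd_i = 0`, `g_kᵀg_i = 0` and `d_kᵀHd_i = 0` for all `i < k` — the simultaneous induction
(6.29)–(6.37) of the printed proof, the span relation (6.35) being used in the form
`α_iHd_i = g_{i+1} - g_i` (6.19). [cite: AntoniouLu2007, §6.4 Theorem 6.4, (6.24)-(6.37)] -/
theorem conjugateGradient_invariants (hH : Hᵀ = H) (hg : ∀ k, g k = b + H *ᵥ x k)
    (hx : ∀ k, x (k + 1) = x k + α k • d k) (hd0 : d 0 = -g 0)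
    (hd : ∀ k, d (k + 1) = -g (k + 1) + β k • d k)
    (hα : ∀ k, α k * (d k ⬝ᵥ H *ᵥ d k) = -(g k ⬝ᵥ d k))
    (hβ : ∀ k, β k * (d k ⬝ᵥ H *ᵥ d k) = g (k + 1) ⬝ᵥ H *ᵥ d k) {K : ℕ}
    (hαne : ∀ i < K, α i ≠ 0) :
    ∀ k ≤ K, (∀ i < k, g k ⬝ᵥ d i = 0) ∧ (∀ i < k, g k ⬝ᵥ g i = 0) ∧
      (∀ i < k, d k ⬝ᵥ H *ᵥ d i = 0) := by
  -- the gradients lie in the span of two consecutive directions: `g_j` from `d_j`, `d_{j-1}`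
  have hgd : ∀ (w : n → ℝ) (j : ℕ), (∀ i ≤ j, w ⬝ᵥ d i = 0) → w ⬝ᵥ g j = 0 := by
    intro w j hw
    rcases j with _ | j
    · have : g 0 = -d 0 := by rw [hd0, neg_neg]
      rw [this, dotProduct_neg, hw 0 le_rfl, neg_zero]
    · have : g (j + 1) = -d (j + 1) + β j • d j := by rw [hd j]; abel
      rw [this, dotProduct_add, dotProduct_neg, dotProduct_smul, hw (j + 1) le_rfl,
        hw j (Nat.le_succ j), smul_zero, neg_zero, add_zero]
  intro k
  induction k with
  | zero =>
    intro _
    exact ⟨fun i hi => absurd hi (Nat.not_lt_zero i), fun i hi => absurd hi (Nat.not_lt_zero i),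
      fun i hi => absurd hi (Nat.not_lt_zero i)⟩
  | succ k ih =>
    intro hk
    have hkK : k < K := Nat.lt_of_succ_le hk
    obtain ⟨ih1, -, ih3⟩ := ih (Nat.le_of_lt hkK)
    -- (i') Theorem 6.3(a) at level k+1
    have h1 : ∀ i < k + 1, g (k + 1) ⬝ᵥ d i = 0 := by
      intro i hi
      rcases Nat.lt_succ_iff_lt_or_eq.mp hi with hlt | rfl
      · rw [grad_succ hg hx, add_dotProduct, smul_dotProduct, smul_eq_mul, ih1 i hlt,
          dotProduct_comm (H *ᵥ d k), form_comm hH (d i) (d k), ih3 i hlt, mul_zero, add_zero]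
      · exact grad_dotProduct_dir_self hg hx hα i
    -- (ii') orthogonality of gradients at level k+1
    have h2 : ∀ i < k + 1, g (k + 1) ⬝ᵥ g i = 0 := by
      intro i hi
      exact hgd (g (k + 1)) i (fun j hj => h1 j (Nat.lt_succ_of_le (le_trans hj (Nat.lt_succ_iff.mp hi))))
    -- (iii') conjugacy at level k+1
    have h3 : ∀ i < k + 1, d (k + 1) ⬝ᵥ H *ᵥ d i = 0 := by
      intro i hi
      rw [hd k, add_dotProduct, neg_dotProduct, smul_dotProduct, smul_eq_mul]
      rcases Nat.lt_succ_iff_lt_or_eq.mp hi with hlt | rfl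
      · -- i < k: `α_i g_{k+1}ᵀHd_i = g_{k+1}ᵀ(g_{i+1} - g_i) = 0`, `α_i ≠ 0`
        have hs : α i • H *ᵥ d i = g (i + 1) - g i := by
          rw [grad_succ hg hx i]; abel
        have hz : α i * (g (k + 1) ⬝ᵥ H *ᵥ d i) = 0 := by
          rw [← smul_eq_mul, ← dotProduct_smul, hs, dotProduct_sub,
            h2 (i + 1) (Nat.succ_lt_succ hlt), h2 i hi, sub_zero]
        have hgi : g (k + 1) ⬝ᵥ H *ᵥ d i = 0 :=
          (mul_eq_zero.mp hz).resolve_left (hαne i (lt_trans hlt hkK))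
        rw [hgi, ih3 i hlt, neg_zero, mul_zero, add_zero]
      · -- i = k: the choice (6.28) of β_k, (6.34)
        linarith [hβ i]
    exact ⟨h1, h2, h3⟩

/-- **Theorem 6.4(b): the conjugate-gradient gradients are mutually orthogonal**, `g_kᵀg_i = 0`
for `i < k ≤ K`. [cite: AntoniouLu2007, §6.4 Theorem 6.4(b)] -/
theorem conjugateGradient_gradients_orthogonal (hH : Hᵀ = H) (hg : ∀ k, g k = b + H *ᵥ x k)
    (hx : ∀ k, x (k + 1) = x k + α k • d k) (hd0 : d 0 = -g 0)
    (hd : ∀ k, d (k + 1) = -g (k + 1) + β k • d k)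
    (hα : ∀ k, α k * (d k ⬝ᵥ H *ᵥ d k) = -(g k ⬝ᵥ d k))
    (hβ : ∀ k, β k * (d k ⬝ᵥ H *ᵥ d k) = g (k + 1) ⬝ᵥ H *ᵥ d k) {K : ℕ}
    (hαne : ∀ i < K, α i ≠ 0) {k i : ℕ} (hk : k ≤ K) (hi : i < k) :
    g k ⬝ᵥ g i = 0 :=
  (conjugateGradient_invariants hH hg hx hd0 hd hα hβ hαne k hk).2.1 i hi

/-- **(6.38): `-g_kᵀd_k = g_kᵀg_k`** for the conjugate-gradient directions, since
`d_k = -g_k + β_{k-1}d_{k-1}` and `g_kᵀd_{k-1} = 0` (Theorem 6.3(a)); hence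
`α_k = g_kᵀg_k / d_kᵀHd_k`. [cite: AntoniouLu2007, §6.4 (6.38)] -/
theorem cg_neg_grad_dotProduct_dir (hd0 : d 0 = -g 0)
    (hd : ∀ k, d (k + 1) = -g (k + 1) + β k • d k)
    (horth : ∀ k, g (k + 1) ⬝ᵥ d k = 0) (k : ℕ) :
    -(g k ⬝ᵥ d k) = g k ⬝ᵥ g k := by
  rcases k with _ | k
  · rw [hd0, dotProduct_neg, neg_neg]
  · rw [hd k, dotProduct_add, dotProduct_neg, dotProduct_smul, horth k, smul_zero, add_zero,
      neg_neg]

/-- **(6.39)–(6.40): the Fletcher–Reeves form `β_k = g_{k+1}ᵀg_{k+1} / g_kᵀg_k`.** From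
`α_kHd_k = g_{k+1} - g_k` (6.19), `g_{k+1}ᵀg_k = 0` (6.40) and `-g_kᵀd_k = g_kᵀg_k` (6.38):
`β_k d_kᵀHd_k = g_{k+1}ᵀHd_k` and `α_k d_kᵀHd_k = g_kᵀg_k` give `β_k g_kᵀg_k = g_{k+1}ᵀg_{k+1}`,
so for `g_k ≠ 0` the printed quotient. [cite: AntoniouLu2007, §6.4 (6.38)-(6.40)] -/
theorem cg_beta_fletcherReeves (hg : ∀ k, g k = b + H *ᵥ x k)
    (hx : ∀ k, x (k + 1) = x k + α k • d k)
    (hα : ∀ k, α k * (d k ⬝ᵥ H *ᵥ d k) = -(g k ⬝ᵥ d k))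
    (hβ : ∀ k, β k * (d k ⬝ᵥ H *ᵥ d k) = g (k + 1) ⬝ᵥ H *ᵥ d k) {k : ℕ}
    (h38 : -(g k ⬝ᵥ d k) = g k ⬝ᵥ g k) (h40 : g (k + 1) ⬝ᵥ g k = 0)
    (hgk : g k ⬝ᵥ g k ≠ 0) :
    β k = (g (k + 1) ⬝ᵥ g (k + 1)) / (g k ⬝ᵥ g k) := by
  -- `α_k (g_{k+1}ᵀHd_k) = g_{k+1}ᵀg_{k+1} - g_{k+1}ᵀg_k = g_{k+1}ᵀg_{k+1}` (6.39)
  have h39 : α k * (g (k + 1) ⬝ᵥ H *ᵥ d k) = g (k + 1) ⬝ᵥ g (k + 1) := by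
    have hs : α k • H *ᵥ d k = g (k + 1) - g k := by rw [grad_succ hg hx k]; abel
    rw [← smul_eq_mul, ← dotProduct_smul, hs, dotProduct_sub, h40, sub_zero]
  have hq : α k * (d k ⬝ᵥ H *ᵥ d k) = g k ⬝ᵥ g k := by rw [hα k, h38]
  have hαk : α k ≠ 0 := by
    intro h0; rw [h0, zero_mul] at hq; exact hgk hq.symm
  have hqk : d k ⬝ᵥ H *ᵥ d k ≠ 0 := by
    intro h0; rw [h0, mul_zero] at hq; exact hgk hq.symm
  rw [eq_div_iff hgk]
  -- β_k g_kᵀg_k = β_k α_k d_kᵀHd_k = α_k g_{k+1}ᵀHd_k = g_{k+1}ᵀg_{k+1}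
  calc β k * (g k ⬝ᵥ g k) = α k * (β k * (d k ⬝ᵥ H *ᵥ d k)) := by rw [← hq]; ring
    _ = g (k + 1) ⬝ᵥ g (k + 1) := by rw [hβ k, h39]

end ConjugateGradient

end Literature.Analysis.Convex.ConjugateDirections
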